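import Summits.QuantumFields.YangMills.Theorems.UnitScaleTiltProp8ChartIterSmall
import Summits.QuantumFields.YangMills.Theorems.BalabanUVNodesPortS1JacobianHoloSL2
import Literature.MathematicalPhysics.QuantumFieldTheory.Balaban1983to89.LatticeWordStokes

/-!
# NODE O port PT-A — THE BRIDGE `emlIterU ↔ iterMh` AND THE `k`-UNIFORM TOWER LOOP BOUND FROM SMALL READS: a `det = 1` units-valued fine field whose bonds are within `s₀` of `1`, under the
# ★19200-p2 budget `6400ℓ²Lᵏs₀ ≤ 1` (`ℓ = (d+2)L`), has ALL its (0.4) averages `Ū^{(j)}`, `j ≤ k`, equal (as matrices) to the holomorphic iterates `iterMh j`, of determinant `1`, within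
# `30ℓLᵏs₀` of `1` bondwise, and with every (0.4) loop matrix within `120ℓ²Lᵏs₀` of `1` — [B7] Props. 1–2-type smallness UNIFORM IN `k`, imported from the ym3-torus lane's kernel theorem
# `Prop8Chart.norm_emlIterU_sub_one_le_of_reads` (any complete normed ℂ-algebra, any `Params`)

Cell `ym-nodeO-ideate`, porter seat `ymgap-nodeO-port-PTA-1` (gen 6); proof file, `--supports stmt-QuantumFields-27930`.  [I] = [Balaban1987RG1], [B7] = [Balaban1985Averaging].  Toward
`JacKStepCore F` (✓ `…JacKStepCoreDefs`): after the cluster axial gauge and the splice by `1` off the tower region, a record pair's field has small reads EVERYWHERE, and this file turns small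
reads into tower loop-smallness of the holomorphic iterates.
CONTENTS (theorems only; `𝔸 = M₂(ℂ)` with the `L²`-operator norm).
* §1 `units_coe_inv_eq_adjugate` · ★ `coe_holT_eq_holMh` (the group transport `holT` of a `det = 1` units field, read in matrices, is the holomorphic walk product `holMh` — inverse = adjugate) ·
  `coe_loopHolU_eq_loopMh` · ★ `coe_emlAvgU_eq_avgMh` (one (0.4) step: ★19200-p2's unguarded units average = dag-n12's holomorphic matrix average, at `det = 1` fields).
* §2 `norm_units_inv_sub_one_le` · `norm_holT_sub_one_le` (a transport along a word of length `n` over bonds within `δ` of `1` (inverses too) is within `(1+δ)ⁿ − 1` of `1`) · `pow_succ_sub_one_le`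
  (`(1+δ)ⁿ − 1 ≤ 2nδ` for `nδ ≤ 1`).
* §3 ★★★ `towerBridge_of_reads` — for `W : T⁽⁰⁾-bonds → M₂(ℂ)ˣ` with `det W = 1`, `‖W(b) − 1‖ ≤ s₀` everywhere and `6400ℓ²Lᵏs₀ ≤ 1`, for every `j ≤ k` (`k ≤ m + K`): `Ū^{(j)}[W] = iterMh j W`
  bondwise, `det = 1`, `‖Ū^{(j)}(e) − 1‖ ≤ 30ℓLᵏs₀`, and `‖loopMh (iterMh j W) c i − 1‖ ≤ 120ℓ²Lᵏs₀` at EVERY coarse bond (induction over levels: reads bound ⇒ loops `< 1∕3` ⇒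
  `det Ū = 1` (`…JacobianHoloSL2.det_avgMh_eq_one`) ⇒ the bridge one level up).

HONEST FRAMING.  Bookkeeping over ★19200-p2's `Prop8Chart*` (its estimate is COMPOSED, not re-proved), dag-n12's `B15AveragingHolomorphic` and PTZ-1's `det` lemma; NOTHING of Bałaban
asserted or re-proved; `JacKStepCore` ∕ `stub_LZjacKStep` ∕ `stub_LZjacDom` OPEN; 27930 OPEN · no claim; K0⁷∕K-Ax OPEN; NODE O 0∕1; COUNT 8∕28 · K 1∕4 UNMOVED; finite `𝕋⁴_{L^K}` at fixed ε — NOT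
continuum ∕ OS ∕ Clay; **the Yang–Mills mass gap is NOT proved by any of this.**  No `sorry`, no `def`, no `instance`, no `notation`; standard axioms.
-/

noncomputable section

open scoped BigOperators Matrix.Norms.L2Operator Topology

namespace Summit.QuantumFields.YangMills.Theorems.BalabanUVNodesPortS1

open Summit.QuantumFields.YangMills.Theorems.K0RecordFormatNames
open Literature.MathematicalPhysics.QuantumFieldTheory.Balaban1983to89
open Literature.MathematicalPhysics.QuantumFieldTheory.Balaban1983to89.Node00
open Literature.MathematicalPhysics.QuantumFieldTheory.Balaban1983to89.T4Continuum (walk Letter LStep loopWord)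
open Literature.MathematicalPhysics.QuantumFieldTheory.Balaban1983to89.BlockAveraging (Idx off)
open Literature.MathematicalPhysics.QuantumFieldTheory.Balaban1983to89.B10Eq27TorusAxialLog (holT holT_nil holT_cons_true holT_cons_false)
open Literature.MathematicalPhysics.QuantumFieldTheory.Balaban1983to89.B15AveragingHolomorphic
  (holMh stepMh loopMh axialMh corrMh avgMh iterMh holMh_nil holMh_cons iterMh_zero iterMh_succ)
open Summit.QuantumFields.YangMills.Theorems.Prop8Chart (emlAvgU emlIterU loopHolU coe_emlAvgU emlIterU_succ norm_emlIterU_sub_one_le_of_reads)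
open _root_.Matrix

variable {P : Params}

/-! ## §1  The bridge: group transports of `det = 1` units fields are the holomorphic walk products -/

/-- A unit of `M₂(ℂ)` with `det = 1` has inverse equal to its adjugate. [folklore] -/
theorem units_coe_inv_eq_adjugate (u : (MatA 2)ˣ) (hu : ((u : (MatA 2)ˣ) : MatA 2).det = 1) :
    ((u⁻¹ : (MatA 2)ˣ) : MatA 2) = ((u : (MatA 2)ˣ) : MatA 2).adjugate := by
  have h : ((u : (MatA 2)ˣ) : MatA 2) * ((u : (MatA 2)ˣ) : MatA 2).adjugate = 1 := by rw [mul_adjugate, hu, one_smul]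
  calc ((u⁻¹ : (MatA 2)ˣ) : MatA 2) = ((u⁻¹ : (MatA 2)ˣ) : MatA 2) * (((u : (MatA 2)ˣ) : MatA 2) * ((u : (MatA 2)ˣ) : MatA 2).adjugate) := by
        rw [h, mul_one]
    _ = ((u : (MatA 2)ˣ) : MatA 2).adjugate := by rw [← mul_assoc, Units.inv_mul, one_mul]

/-- ★ **`holT = holMh` in matrices** for a units field of determinant `1`: the group transport along a word (inverses on backward letters) read in `M₂(ℂ)` is the holomorphic walk product
(adjugates on backward steps). [cite: Balaban1987RG1, (0.4) p.253 (bookkeeping)] -/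
theorem coe_holT_eq_holMh {j : ℕ} (W : GaugeField P j (MatA 2)ˣ) (hW : ∀ b, ((W b : (MatA 2)ˣ) : MatA 2).det = 1) :
    ∀ (w : List (Letter P.d)) (x : Site P j), ((holT W x w : (MatA 2)ˣ) : MatA 2) = holMh (fun b => ((W b : (MatA 2)ˣ) : MatA 2)) (walk x w)
  | [], x => by simp [walk]
  | (μ, true) :: w, x => by
    rw [holT_cons_true, Units.val_mul, coe_holT_eq_holMh W hW w]
    simp [walk, holMh_cons, stepMh]
  | (μ, false) :: w, x => by
    rw [holT_cons_false, Units.val_mul, coe_holT_eq_holMh W hW w, units_coe_inv_eq_adjugate _ (hW _)]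
    simp [walk, holMh_cons, stepMh]

/-- The (0.4) loop units of ★19200-p2 read in matrices are dag-n12's holomorphic loop matrices (`det = 1` fields). [cite: Balaban1987RG1, (0.4) p.253 (bookkeeping)] -/
theorem coe_loopHolU_eq_loopMh {j : ℕ} (W : GaugeField P j (MatA 2)ˣ) (hW : ∀ b, ((W b : (MatA 2)ˣ) : MatA 2).det = 1) (c : PBond P (j + 1)) (i : Idx P) :
    ((loopHolU W c i : (MatA 2)ˣ) : MatA 2) = loopMh (fun b => ((W b : (MatA 2)ˣ) : MatA 2)) c i :=
  coe_holT_eq_holMh W hW _ _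

/-- ★ **ONE (0.4) STEP: `emlAvgU = avgMh` in matrices** at `det = 1` units fields. [cite: Balaban1987RG1, (0.4) p.253] -/
theorem coe_emlAvgU_eq_avgMh {j : ℕ} (W : GaugeField P j (MatA 2)ˣ) (hW : ∀ b, ((W b : (MatA 2)ˣ) : MatA 2).det = 1) (c : PBond P (j + 1)) :
    ((emlAvgU W c : (MatA 2)ˣ) : MatA 2) = avgMh (fun b => ((W b : (MatA 2)ˣ) : MatA 2)) c := by
  rw [coe_emlAvgU, coe_holT_eq_holMh W hW]
  have hl : (fun i : Idx P => ((loopHolU W c i : (MatA 2)ˣ) : MatA 2)) = fun i => loopMh (fun b => ((W b : (MatA 2)ˣ) : MatA 2)) c i :=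
    funext fun i => coe_loopHolU_eq_loopMh W hW c i
  rw [hl]
  rfl

/-! ## §2  Elementary bounds: inverses and transports of near-`1` units -/

/-- The inverse of a unit within `m ≤ 1∕2` of `1` is within `2m` of `1`. [folklore] -/
theorem norm_units_inv_sub_one_le {u : (MatA 2)ˣ} {m : ℝ} (hm : m ≤ 1 / 2) (h : ‖((u : (MatA 2)ˣ) : MatA 2) - 1‖ ≤ m) :
    ‖((u⁻¹ : (MatA 2)ˣ) : MatA 2) - 1‖ ≤ 2 * m := by
  set t : ℝ := ‖((u⁻¹ : (MatA 2)ˣ) : MatA 2) - 1‖ with ht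
  have hm0 : 0 ≤ m := le_trans (norm_nonneg _) h
  have he : ((u⁻¹ : (MatA 2)ˣ) : MatA 2) - 1 = ((u⁻¹ : (MatA 2)ˣ) : MatA 2) * (1 - ((u : (MatA 2)ˣ) : MatA 2)) := by
    rw [mul_sub, mul_one, Units.inv_mul]
  have hn : ‖((u⁻¹ : (MatA 2)ˣ) : MatA 2)‖ ≤ t + 1 := by
    calc ‖((u⁻¹ : (MatA 2)ˣ) : MatA 2)‖ = ‖(((u⁻¹ : (MatA 2)ˣ) : MatA 2) - 1) + 1‖ := by rw [sub_add_cancel]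
      _ ≤ t + ‖(1 : MatA 2)‖ := norm_add_le _ _
      _ = t + 1 := by rw [norm_one]
  have h1 : t ≤ (t + 1) * m := by
    calc t = ‖((u⁻¹ : (MatA 2)ˣ) : MatA 2) * (1 - ((u : (MatA 2)ˣ) : MatA 2))‖ := by rw [ht, he]
      _ ≤ ‖((u⁻¹ : (MatA 2)ˣ) : MatA 2)‖ * ‖1 - ((u : (MatA 2)ˣ) : MatA 2)‖ := norm_mul_le _ _
      _ ≤ (t + 1) * m :=
        mul_le_mul hn (by rwa [norm_sub_rev]) (norm_nonneg _) (by linarith [norm_nonneg (((u⁻¹ : (MatA 2)ˣ) : MatA 2) - 1)])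
  nlinarith [norm_nonneg (((u⁻¹ : (MatA 2)ˣ) : MatA 2) - 1)]

/-- A transport along a word of length `n` over a units field whose bonds AND inverses are within `δ` of `1` is within `(1+δ)ⁿ − 1` of `1`. [cite: Balaban1985Averaging, (22)–(23) p.22 (bookkeeping)] -/
theorem norm_holT_sub_one_le {j : ℕ} (W : GaugeField P j (MatA 2)ˣ) {δ : ℝ} (hδ : 0 ≤ δ) (h1 : ∀ b, ‖((W b : (MatA 2)ˣ) : MatA 2) - 1‖ ≤ δ)
    (h2 : ∀ b, ‖(((W b)⁻¹ : (MatA 2)ˣ) : MatA 2) - 1‖ ≤ δ) :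
    ∀ (w : List (Letter P.d)) (x : Site P j), ‖((holT W x w : (MatA 2)ˣ) : MatA 2) - 1‖ ≤ (1 + δ) ^ w.length - 1
  | [], x => by simp
  | (μ, b) :: w, x => by
    have ih := norm_holT_sub_one_le W hδ h1 h2 w
    have key : ∀ (a B : MatA 2) (r : ℝ), ‖a - 1‖ ≤ δ → ‖B - 1‖ ≤ r → ‖a * B - 1‖ ≤ (1 + δ) * (1 + r) - 1 := by
      intro a B r ha hB
      have hr : 0 ≤ r := le_trans (norm_nonneg _) hB
      have e : a * B - 1 = (a - 1) * (B - 1) + (a - 1) + (B - 1) := by noncomm_ring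
      calc ‖a * B - 1‖ = ‖(a - 1) * (B - 1) + (a - 1) + (B - 1)‖ := by rw [e]
        _ ≤ ‖(a - 1) * (B - 1)‖ + ‖a - 1‖ + ‖B - 1‖ := norm_add₃_le
        _ ≤ δ * r + δ + r := by gcongr; exact (norm_mul_le _ _).trans (by gcongr)
        _ = (1 + δ) * (1 + r) - 1 := by ring
    cases b with
    | true =>
      rw [holT_cons_true, Units.val_mul, List.length_cons, pow_succ']
      have := key _ _ _ (h1 ⟨x, μ⟩) (ih (x.shift μ))
      linarith [this]
    | false =>
      rw [holT_cons_false, Units.val_mul, List.length_cons, pow_succ']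
      have := key _ _ _ (h2 ⟨x.unshift μ, μ⟩) (ih (x.unshift μ))
      linarith [this]

/-- `(1+δ)ⁿ − 1 ≤ 2nδ` for `0 ≤ δ`, `nδ ≤ 1` (through `(1+δ)ⁿ ≤ e^{nδ} ≤ 1 + nδ + (nδ)²`). [folklore] -/
theorem pow_succ_sub_one_le {δ : ℝ} {n : ℕ} (hδ : 0 ≤ δ) (h : (n : ℝ) * δ ≤ 1) : (1 + δ) ^ n - 1 ≤ 2 * ((n : ℝ) * δ) := by
  have h1 : (1 + δ) ^ n ≤ Real.exp ((n : ℝ) * δ) := by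
    calc (1 + δ) ^ n ≤ (Real.exp δ) ^ n := by
          gcongr
          have := Real.add_one_le_exp δ; linarith
      _ = Real.exp ((n : ℝ) * δ) := by rw [← Real.exp_nat_mul]
  have h0 : 0 ≤ (n : ℝ) * δ := by positivity
  have h2 : Real.exp ((n : ℝ) * δ) - 1 - (n : ℝ) * δ ≤ ((n : ℝ) * δ) ^ 2 := by
    have := Real.abs_exp_sub_one_sub_id_le (x := (n : ℝ) * δ) (by rw [abs_of_nonneg h0]; exact h)
    exact (le_abs_self _).trans this
  nlinarith [h1, h2, h0, h]

/-! ## §3  ★★★ Small reads everywhere ⇒ the bridge, `det = 1`, small bonds and small loops at every level `j ≤ k`, uniformly in `k` -/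

/-- ★★★ **THE TOWER BRIDGE AND LOOP BOUND FROM SMALL READS.**  For a units field `W` on the fine torus with `det W(b) = 1` and `‖W(b) − 1‖ ≤ s₀` at EVERY bond, under the budget
`6400ℓ²Lᵏs₀ ≤ 1` (`ℓ = (d+2)L`, `k ≤ m + K`): for every `j ≤ k`, (1) `Ū^{(j)}[W](e) = iterMh j W e` for every level-`j` bond, (2) `det Ū^{(j)}(e) = 1`, (3) `‖Ū^{(j)}(e) − 1‖ ≤ 30ℓLᵏs₀`,
(4) `‖loopMh (iterMh j W) c i − 1‖ ≤ 120ℓ²Lᵏs₀` at every level-`(j+1)` bond `c` and index `i`.  ((3) is ★19200-p2's `norm_emlIterU_sub_one_le_of_reads` with `S = univ`; (4) from (3) along the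
loop words of length `≤ ℓ`; (1)(2) by induction, `det Ū = 1` one level up from loops `< 1∕3`.) [cite: Balaban1987RG1, p.263 L8–10, (0.4) p.253; Balaban1985Averaging, Prop. 2 (54) p.26, Prop. 4 (134)–(135) p.38] -/
theorem towerBridge_of_reads {k : ℕ} (hk : k ≤ P.m + P.K) (W : GaugeField P 0 (MatA 2)ˣ) (hdet : ∀ b, ((W b : (MatA 2)ˣ) : MatA 2).det = 1)
    {s₀ : ℝ} (hs₀ : 0 ≤ s₀) (hW : ∀ b, ‖((W b : (MatA 2)ˣ) : MatA 2) - 1‖ ≤ s₀)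
    (hbudget : 6400 * (((P.d + 2) * P.L : ℕ) : ℝ) ^ 2 * (P.L : ℝ) ^ k * s₀ ≤ 1) :
    ∀ j : ℕ, j ≤ k →
      (∀ e : PBond P j, ((emlIterU j W e : (MatA 2)ˣ) : MatA 2) = iterMh j (fun b => ((W b : (MatA 2)ˣ) : MatA 2)) e) ∧
      (∀ e : PBond P j, (((emlIterU j W e : (MatA 2)ˣ) : MatA 2)).det = 1) ∧
      (∀ e : PBond P j, ‖((emlIterU j W e : (MatA 2)ˣ) : MatA 2) - 1‖ ≤ 30 * (((P.d + 2) * P.L : ℕ) : ℝ) * (P.L : ℝ) ^ k * s₀) ∧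
      (∀ (c : PBond P (j + 1)) (i : Idx P),
        ‖loopMh (iterMh j (fun b => ((W b : (MatA 2)ˣ) : MatA 2))) c i - 1‖ ≤ 120 * (((P.d + 2) * P.L : ℕ) : ℝ) ^ 2 * (P.L : ℝ) ^ k * s₀) := by
  set ℓ : ℝ := (((P.d + 2) * P.L : ℕ) : ℝ) with hℓ
  have hℓ1 : (1 : ℝ) ≤ ℓ := by
    rw [hℓ]; exact_mod_cast Nat.one_le_iff_ne_zero.mpr (Nat.mul_ne_zero (by omega) (by have := P.hL.2; omega))
  have hℓ0 : (0 : ℝ) ≤ ℓ := by linarith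
  have hL1 : (1 : ℝ) ≤ P.L := by exact_mod_cast (show 1 ≤ P.L by have := P.hL.2; omega)
  set x : ℝ := (P.L : ℝ) ^ k * s₀ with hx
  have hx0 : 0 ≤ x := by positivity
  have hbx : 6400 * ℓ ^ 2 * x ≤ 1 := by rw [hx]; linarith [hbudget]
  -- the bond bound `m := 30 ℓ x` and its consequences
  set m : ℝ := 30 * ℓ * x with hm
  have hm0 : 0 ≤ m := by positivity
  have hℓx : ℓ * x ≤ 1 / 6400 := by nlinarith [hbx, hℓ1, hx0]
  have hmhalf : m ≤ 1 / 2 := by rw [hm]; nlinarith [hℓx]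
  have hℓm : ℓ * (2 * m) ≤ 1 := by rw [hm]; nlinarith [hbx, hℓ0, hx0]
  -- (3) at every level `j ≤ k`: ★19200-p2's reads bound with `S = univ`
  have h3 : ∀ j, j ≤ k → ∀ e : PBond P j, ‖((emlIterU j W e : (MatA 2)ˣ) : MatA 2) - 1‖ ≤ m := by
    intro j hj e
    have hjK : j ≤ P.m + P.K := hj.trans hk
    have hbj : 6400 * (((P.d + 2) * P.L : ℕ) : ℝ) ^ 2 * (P.L : ℝ) ^ j * s₀ ≤ 1 := by
      have hpow : (P.L : ℝ) ^ j ≤ (P.L : ℝ) ^ k := pow_le_pow_right₀ hL1 hj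
      calc 6400 * (((P.d + 2) * P.L : ℕ) : ℝ) ^ 2 * (P.L : ℝ) ^ j * s₀ ≤ 6400 * (((P.d + 2) * P.L : ℕ) : ℝ) ^ 2 * (P.L : ℝ) ^ k * s₀ := by gcongr
        _ ≤ 1 := hbudget
    have h := norm_emlIterU_sub_one_le_of_reads hjK (Set.univ : Set (Site P j)) W hs₀ hbj (fun b _ _ => hW b) e (Set.mem_univ _) (Set.mem_univ _)
    calc ‖((emlIterU j W e : (MatA 2)ˣ) : MatA 2) - 1‖ ≤ 30 * (((P.d + 2) * P.L : ℕ) : ℝ) * (P.L : ℝ) ^ j * s₀ := h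
      _ ≤ 30 * ℓ * ((P.L : ℝ) ^ k * s₀) := by
        rw [← hℓ, mul_assoc]
        gcongr
      _ = m := by rw [hm, hx]
  -- loops of the units iterates at every level `j ≤ k`
  have hloopU : ∀ j, j ≤ k → ∀ (c : PBond P (j + 1)) (i : Idx P), ‖((loopHolU (emlIterU j W) c i : (MatA 2)ˣ) : MatA 2) - 1‖ ≤ 4 * ℓ * m := by
    intro j hj c i
    have hb1 : ∀ b, ‖((emlIterU j W b : (MatA 2)ˣ) : MatA 2) - 1‖ ≤ 2 * m := fun b => (h3 j hj b).trans (by linarith)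
    have hb2 : ∀ b, ‖(((emlIterU j W b)⁻¹ : (MatA 2)ˣ) : MatA 2) - 1‖ ≤ 2 * m := fun b => norm_units_inv_sub_one_le hmhalf (h3 j hj b)
    have hlen : ((loopWord P.L c.dir (off i.1) i.2.1 i.2.2).length : ℝ) ≤ ℓ := by
      rw [hℓ]; exact_mod_cast LatticeWordStokes.length_loopWord_le c i
    have h := norm_holT_sub_one_le (emlIterU j W) (by positivity) hb1 hb2 (loopWord P.L c.dir (off i.1) i.2.1 i.2.2) (emb c.src)
    have hnum : (1 + 2 * m) ^ (loopWord P.L c.dir (off i.1) i.2.1 i.2.2).length - 1 ≤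
        2 * (((loopWord P.L c.dir (off i.1) i.2.1 i.2.2).length : ℝ) * (2 * m)) :=
      pow_succ_sub_one_le (by positivity) (by nlinarith [hlen, hℓm, hm0])
    calc ‖((loopHolU (emlIterU j W) c i : (MatA 2)ˣ) : MatA 2) - 1‖ ≤ (1 + 2 * m) ^ (loopWord P.L c.dir (off i.1) i.2.1 i.2.2).length - 1 := h
      _ ≤ 2 * (((loopWord P.L c.dir (off i.1) i.2.1 i.2.2).length : ℝ) * (2 * m)) := hnum
      _ ≤ 4 * ℓ * m := by nlinarith [hlen, hm0]
  have h4ℓm : 4 * ℓ * m = 120 * ℓ ^ 2 * x := by rw [hm]; ring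
  have hthird : 4 * ℓ * m < 1 / 3 := by rw [h4ℓm]; nlinarith [hbx]
  -- (1)(2) by induction over the levels
  have h12 : ∀ j, j ≤ k →
      (∀ e : PBond P j, ((emlIterU j W e : (MatA 2)ˣ) : MatA 2) = iterMh j (fun b => ((W b : (MatA 2)ˣ) : MatA 2)) e) ∧
      (∀ e : PBond P j, (((emlIterU j W e : (MatA 2)ˣ) : MatA 2)).det = 1) := by
    intro j
    induction j with
    | zero => intro _; exact ⟨fun e => rfl, fun e => hdet e⟩
    | succ j ih =>
      intro hj
      obtain ⟨hbr, hdj⟩ := ih (Nat.le_of_succ_le hj)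
      have hfun : (fun b => ((emlIterU j W b : (MatA 2)ˣ) : MatA 2)) = iterMh j (fun b => ((W b : (MatA 2)ˣ) : MatA 2)) := funext hbr
      have hstep : ∀ e : PBond P (j + 1), ((emlIterU (j + 1) W e : (MatA 2)ˣ) : MatA 2) = avgMh (iterMh j (fun b => ((W b : (MatA 2)ˣ) : MatA 2))) e := by
        intro e
        rw [emlIterU_succ, ← hfun]
        exact coe_emlAvgU_eq_avgMh (emlIterU j W) hdj e
      have hpoly : ∀ (e : PBond P (j + 1)) (i : Idx P), ‖loopMh (iterMh j (fun b => ((W b : (MatA 2)ˣ) : MatA 2))) e i - 1‖ < 1 / 3 := by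
        intro e i
        rw [← hfun, ← coe_loopHolU_eq_loopMh (emlIterU j W) hdj e i]
        exact (hloopU j (Nat.le_of_succ_le hj) e i).trans_lt hthird
      refine ⟨fun e => by rw [hstep e, iterMh_succ], fun e => ?_⟩
      rw [hstep e]
      exact det_avgMh_eq_one _ (fun b => by rw [← hfun]; exact hdj b) e (hpoly e)
  intro j hj
  obtain ⟨hbr, hdj⟩ := h12 j hj
  have hfun : (fun b => ((emlIterU j W b : (MatA 2)ˣ) : MatA 2)) = iterMh j (fun b => ((W b : (MatA 2)ˣ) : MatA 2)) := funext hbr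
  refine ⟨hbr, hdj, fun e => ?_, fun c i => ?_⟩
  · have := h3 j hj e; rw [hm, hx] at this; linarith [this]
  · rw [← hfun, ← coe_loopHolU_eq_loopMh (emlIterU j W) hdj c i]
    have := hloopU j hj c i
    rw [h4ℓm, hx] at this
    linarith [this]

end Summit.QuantumFields.YangMills.Theorems.BalabanUVNodesPortS1

end
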